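import Summits.RiemannHypothesis.RiemannHypothesis.Theorems.JensenPolynomialsFarGumbelPhase
import Mathlib.Analysis.Complex.ExponentialBounds

/-!
# Route `JensenPolynomials`, FAR crux `XiWindowZeroFreeRelFar` (B1-rel far) — S3 pointwise input (R1): the third derivative of
the far phase on the window is `≤ 180·Λ` (RH-FREE; cell rh-jensen, HUMAN RULING D-0040)

For the window hypothesis (W) of `FarGumbel.laplaceFar_of_pointwise` via `FarGumbel.window_of_farPsi3_le` (item
`stmt-RiemannHypothesis-19465`, stub S3): on the box `|Re u − υ| ≤ 1/4`, `|Im u| ≤ 1/10` (which contains the saddle window: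
`|Re ξ_s| ≤ 0.45 ⇒ |Re u_s − υ| ≤ 0.12`), with the far-mode equation `4πe^{4υ}υ = 2M + 9υ`, `υ ≥ 189/20`, `‖a‖ ≤ (9/25)υ²`:

  `‖Ψ‴(u)‖ = ‖−64πe^{4u} + 2/u³ + (2M−1)(2u³ − 6ua)/(u²+a)³‖ ≤ 180·Λ`,   `Λ = farLam υ = πe^{4υ}`

(`norm_farPsi3_le`): `64πe^{4x} ≤ 64e·Λ ≤ 174Λ`, `2/|u|³ ≤ 0.003`, and `(2M−1)|u|(2|u|²+6|a|)/|u²+a|³ ≤ 4Λυ·1.04υ·4.32υ²/(0.58υ²)³ ≤ 1.1Λ`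
using `Re(u² + a) ≥ 0.58υ²` on the box (theory g8's S3-BLUEPRINT §3 has the sharper `K₃ ≤ 2.57` in `ξ`-units, i.e. `164Λ`).
WHAT THIS IS NOT: an explicit inequality for an elementary function; nothing here bears on the zeros of `ζ` or the truth of RH.
-/

noncomputable section
-- D-0017: `Summit.RiemannHypothesis.RiemannHypothesis.…` duplicates the namespace BY DESIGN (single-problem summit).
set_option linter.dupNamespace false

namespace Summit.RiemannHypothesis.RiemannHypothesis.Theorems.JensenPolynomials.FarGumbel

open Complex
open scoped Real

/-- On the box `|x − υ| ≤ 1/4`, `|y| ≤ 1/10` (`υ ≥ 189/20`, `‖a‖ ≤ (9/25)υ²`): `Re((x+iy)² + a) ≥ 0.58·υ²`. -/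
theorem re_sq_add_ge_box {υ : ℝ} (hυ : (189 / 20 : ℝ) ≤ υ) {a : ℂ} (ha : ‖a‖ ≤ (9 / 25 : ℝ) * υ ^ 2) {x y : ℝ}
    (hx : |x - υ| ≤ 1 / 4) (hy : |y| ≤ 1 / 10) : (29 / 50 : ℝ) * υ ^ 2 ≤ (((x : ℂ) + y * I) ^ 2 + a).re := by
  have hre : (((x : ℂ) + y * I) ^ 2 + a).re = x ^ 2 - y ^ 2 + a.re := by
    simp [sq, Complex.add_re, Complex.mul_re, Complex.mul_im]
  rw [hre]
  have h1 : -‖a‖ ≤ a.re := by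
    have := Complex.abs_re_le_norm a
    rw [abs_le] at this; exact this.1
  have h2 : y ^ 2 ≤ 1 / 100 := by have := abs_le.mp hy; nlinarith
  have h3 : (υ - 1 / 4) ^ 2 ≤ x ^ 2 := by
    have hx1 := (abs_le.mp hx).1
    have : 0 ≤ υ - 1 / 4 := by linarith
    exact pow_le_pow_left₀ this (by linarith) 2
  nlinarith

/-- Norm of a point of the box: `‖x + iy‖ ≤ υ + 7/20`. -/
theorem norm_mk_le_box {υ x y : ℝ} (hυ : (189 / 20 : ℝ) ≤ υ) (hx : |x - υ| ≤ 1 / 4) (hy : |y| ≤ 1 / 10) :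
    ‖(x : ℂ) + y * I‖ ≤ υ + 7 / 20 := by
  have hx' := abs_le.mp hx
  calc ‖(x : ℂ) + y * I‖ ≤ ‖(x : ℂ)‖ + ‖(y : ℂ) * I‖ := norm_add_le _ _
    _ = |x| + |y| := by simp
    _ ≤ υ + 7 / 20 := by rw [abs_of_nonneg (by linarith)]; linarith

/-- Lower bound of the norm on the box: `‖x + iy‖ ≥ υ − 1/4 ≥ 9.2`. -/
theorem norm_mk_ge_box {υ x y : ℝ} (hx : |x - υ| ≤ 1 / 4) :
    υ - 1 / 4 ≤ ‖(x : ℂ) + y * I‖ := by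
  have hx' := abs_le.mp hx
  calc υ - 1 / 4 ≤ x := by linarith
    _ ≤ |((x : ℂ) + y * I).re| := by simp [le_abs_self]
    _ ≤ ‖(x : ℂ) + y * I‖ := Complex.abs_re_le_norm _

/-- The exponential factor on the box: `‖64π·e^{4u}‖ ≤ 174·Λ`. -/
theorem norm_exp_term_le {υ x y : ℝ} (hx : |x - υ| ≤ 1 / 4) :
    ‖(64 : ℂ) * (π : ℂ) * Complex.exp (4 * ((x : ℂ) + y * I))‖ ≤ 174 * farLam υ := by
  have hx' := abs_le.mp hx
  have hexp : ‖Complex.exp (4 * ((x : ℂ) + y * I))‖ = Real.exp (4 * x) := by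
    rw [Complex.norm_exp]; congr 1; simp
  have he : Real.exp (4 * x) ≤ Real.exp 1 * Real.exp (4 * υ) := by
    rw [← Real.exp_add]; exact Real.exp_monotone (by linarith)
  have he1 : Real.exp 1 < 2.7182818286 := Real.exp_one_lt_d9
  rw [norm_mul, norm_mul, hexp, farLam]
  have hπ : ‖(π : ℂ)‖ = π := by simp [abs_of_pos Real.pi_pos]
  rw [hπ, show ‖(64 : ℂ)‖ = 64 by simp]
  have hpos : 0 < π * Real.exp (4 * υ) := by positivity
  nlinarith [Real.pi_pos, Real.exp_pos (4 * υ)]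

/-- **(R1) The third-derivative bound on the window box.** For the far mode `υ ≥ 189/20` with `4πe^{4υ}υ = 2M + 9υ`,
`‖a‖ ≤ (9/25)υ²`, and `u = x + iy` with `|x − υ| ≤ 1/4`, `|y| ≤ 1/10`: `‖Ψ‴(u)‖ ≤ 180·Λ`. -/
theorem norm_farPsi3_le (M : ℕ) (hM : 1 ≤ M) {υ : ℝ}
    (hυ : (189 / 20 : ℝ) ≤ υ ∧ 4 * Real.pi * Real.exp (4 * υ) * υ = 2 * (M : ℝ) + 9 * υ)
    {a : ℂ} (ha : ‖a‖ ≤ (9 / 25 : ℝ) * υ ^ 2) {x y : ℝ} (hx : |x - υ| ≤ 1 / 4) (hy : |y| ≤ 1 / 10) :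
    ‖farPsi3 M a ((x : ℂ) + y * I)‖ ≤ 180 * farLam υ := by
  obtain ⟨hυ0, hmode⟩ := hυ
  set u : ℂ := (x : ℂ) + y * I with hu
  have hυpos : 0 < υ := by linarith
  have hΛ : farLam υ = (2 * (M : ℝ) + 9 * υ) / (4 * υ) := by
    rw [farLam, eq_div_iff (by positivity)]; linarith [hmode]
  have hΛpos : 0 < farLam υ := by rw [farLam]; positivity
  -- `2M − 1 ≤ 4Λυ`
  have h2M : ‖(2 * (M : ℂ) - 1)‖ ≤ 4 * farLam υ * υ := by
    have hM1 : (1 : ℝ) ≤ M := by exact_mod_cast hM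
    have : ‖(2 * (M : ℂ) - 1)‖ = 2 * (M : ℝ) - 1 := by
      have h : (2 * (M : ℂ) - 1) = ((2 * (M : ℝ) - 1 : ℝ) : ℂ) := by push_cast; ring
      rw [h, Complex.norm_real, Real.norm_of_nonneg (by linarith)]
    rw [this, farLam]
    nlinarith [hmode, hυpos]
  -- geometry of the box
  have hnu := norm_mk_le_box hυ0 hx hy
  have hnl := norm_mk_ge_box (y := y) hx
  have hre := re_sq_add_ge_box hυ0 ha hx hy
  rw [← hu] at hnu hnl hre
  have hυ1 : υ + 7 / 20 ≤ (26 / 25 : ℝ) * υ := by linarith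
  have hnu' : ‖u‖ ≤ (26 / 25 : ℝ) * υ := hnu.trans hυ1
  have hden : (29 / 50 : ℝ) * υ ^ 2 ≤ ‖u ^ 2 + a‖ := hre.trans (Complex.re_le_norm _)
  have hden_pos : 0 < ‖u ^ 2 + a‖ := lt_of_lt_of_le (by positivity) hden
  have hu_pos : 0 < ‖u‖ := lt_of_lt_of_le (by linarith) hnl
  -- term 2: `‖2/u³‖ ≤ 1`
  have hT2 : ‖(2 : ℂ) / u ^ 3‖ ≤ 1 := by
    rw [norm_div, norm_pow, show ‖(2 : ℂ)‖ = 2 by simp, div_le_one (by positivity)]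
    have h9 : (9 : ℝ) ≤ ‖u‖ := by linarith
    nlinarith [pow_le_pow_left₀ (by norm_num : (0:ℝ) ≤ 9) h9 3]
  -- term 3: `(2M−1)|2u³ − 6ua|/|u²+a|³ ≤ 2Λ`
  have hnum : ‖2 * u ^ 3 - 6 * u * a‖ ≤ ‖u‖ * (2 * ‖u‖ ^ 2 + 6 * ‖a‖) := by
    calc ‖2 * u ^ 3 - 6 * u * a‖ ≤ ‖2 * u ^ 3‖ + ‖6 * u * a‖ := norm_sub_le _ _
      _ = ‖u‖ * (2 * ‖u‖ ^ 2 + 6 * ‖a‖) := by simp [norm_pow]; ring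
  have hT3 : ‖(2 * (M : ℂ) - 1) * (2 * u ^ 3 - 6 * u * a) / (u ^ 2 + a) ^ 3‖ ≤ 2 * farLam υ := by
    rw [norm_div, norm_mul, norm_pow, div_le_iff₀ (by positivity)]
    have hA : ‖u‖ * (2 * ‖u‖ ^ 2 + 6 * ‖a‖) ≤ (26 / 25 * υ) * (2 * (26 / 25 * υ) ^ 2 + 6 * ((9 / 25) * υ ^ 2)) := by
      gcongr
    have hB : ((29 / 50 : ℝ) * υ ^ 2) ^ 3 ≤ ‖u ^ 2 + a‖ ^ 3 := pow_le_pow_left₀ (by positivity) hden 3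
    calc ‖(2 * (M : ℂ) - 1)‖ * ‖2 * u ^ 3 - 6 * u * a‖
        ≤ (4 * farLam υ * υ) * ((26 / 25 * υ) * (2 * (26 / 25 * υ) ^ 2 + 6 * ((9 / 25) * υ ^ 2))) :=
          mul_le_mul h2M (hnum.trans hA) (norm_nonneg _) (by positivity)
      _ = farLam υ * υ ^ 4 * (4 * (26 / 25) * (2 * (26 / 25) ^ 2 + 6 * (9 / 25))) := by ring
      _ ≤ 2 * farLam υ * ((29 / 50 : ℝ) * υ ^ 2) ^ 3 := by
          -- `4·1.04·(2·1.0816 + 2.16) = 17.99…` and `2·0.58³ = 0.390…`: need `17.99·υ⁴ ≤ 0.390·υ⁶`, i.e. `υ² ≥ 46.1` (true: `υ² ≥ 89`)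
          have hυ2 : (89 : ℝ) ≤ υ ^ 2 := by nlinarith
          have h4 : 0 ≤ υ ^ 4 := by positivity
          nlinarith [hΛpos, mul_nonneg hΛpos.le h4]
      _ ≤ 2 * farLam υ * ‖u ^ 2 + a‖ ^ 3 := by gcongr
  -- term 1
  have hT1 : ‖-(64 : ℂ) * (π : ℂ) * Complex.exp (4 * u)‖ ≤ 174 * farLam υ := by
    rw [show -(64 : ℂ) * (π : ℂ) * Complex.exp (4 * u) = -((64 : ℂ) * (π : ℂ) * Complex.exp (4 * u)) by ring, norm_neg, hu]
    exact norm_exp_term_le hx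
  -- assemble
  have hΛ3 : (3 : ℝ) ≤ farLam υ := by
    rw [farLam]
    have h1 : (1 : ℝ) ≤ Real.exp (4 * υ) := Real.one_le_exp (by linarith)
    nlinarith [Real.pi_gt_three]
  unfold farPsi3
  calc ‖-64 * (π : ℂ) * Complex.exp (4 * u) + 2 / u ^ 3 + (2 * (M : ℂ) - 1) * (2 * u ^ 3 - 6 * u * a) / (u ^ 2 + a) ^ 3‖
      ≤ ‖-64 * (π : ℂ) * Complex.exp (4 * u) + 2 / u ^ 3‖ + ‖(2 * (M : ℂ) - 1) * (2 * u ^ 3 - 6 * u * a) / (u ^ 2 + a) ^ 3‖ :=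
        norm_add_le _ _
    _ ≤ (‖-64 * (π : ℂ) * Complex.exp (4 * u)‖ + ‖(2 : ℂ) / u ^ 3‖) + 2 * farLam υ :=
        add_le_add (norm_add_le _ _) hT3
    _ ≤ (174 * farLam υ + 1) + 2 * farLam υ := by gcongr
    _ ≤ 180 * farLam υ := by linarith

end Summit.RiemannHypothesis.RiemannHypothesis.Theorems.JensenPolynomials.FarGumbel

end
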